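import Mathlib
import HarnessLib
import Summits.NavierStokesRegularity.NavierStokesRegularity.Theorems.PoloidalWindowDoorPoloidalWindowRigiditySeparatedShearVariance
import Summits.NavierStokesRegularity.NavierStokesRegularity.Theorems.PoloidalWindowDoorPoloidalWindowRigidityTimeShearPressure

/-!
# Route `PoloidalWindowDoor`, crux `PoloidalWindowRigidity` (K2, stmt-NavierStokesRegularity-19708) — the stratum (TV)
# «time-dependent proportional shear»: the KEY inequality with the source `2κV` and `Ψ' ≤ (3M₀/L + 2κ)Ψ + O(L/R)`

Cell ns-regularity-ideate, seat ns-poloidal-K2-p3 gen 4 (stub-worker under the K2 lead; file landed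
`--supports stmt-NavierStokesRegularity-19708` as a helper).  First brick of the GLOBAL exclusion of (TV) asked by
refuter1's K-a″ (STATUS 2026-08-27T09:14Z) — `stub_tv` of `…K2OfLrcSpatial.nonflatLiouville_of_lrc_spatial`: the
(M)-consuming chain M12 of ns-poloidal-K2-p2 (`…ConstantShear*`, `…SeparatedShear*`, p511024/p517024) re-run on the stratum
`∂₂v_b(s,·) ≡ μ(s) ∂_b v₂(s,·)` (`b = 0,1`, all slices) with a TIME-DEPENDENT slope `μ`.  There the pressure is NOT separated
(`…TimeShearPressure.timeShear_pressure`: `∇_h f₂ = κ ∇_h v₂`, `κ = μ′/(1 − μ)`), but `F := f₂ − κ v₂` IS height-only,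
and K2-p2's one-slice bricks (`…SeparatedShearEnergy.key_mean_sep`, abstract continuous time-derivative slot `θt`) apply
VERBATIM with `θt := ∂ₜv₂ − κ v₂`: the variance law acquires exactly the source `2κV`.

* `residual_vert_sub_eq_of_height_eq_TV` — `F = f₂ − κ v₂` depends on `(t, x₂)` only;
* `sliceDsep_nonneg_TV` — on (TV) the Clebsch production is `(1 − μ)|∇_h v₂|² ≥ 0` (`μ < 1`);
* `key_slice_TV` — **`∂ₜV − 2κV + 2∂_zG + 2Dsep ≤ R⁻¹(8M₀³ + 8M₀M₁)K`** (`κ = μ′(t)/(1 − μ(t))`);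
* `deriv_psi_le_TV` — **`Ψ' ≤ (3M₀/L)Ψ + 2κΨ + πL·K(t)/R`** for the weighted variance `Ψ = ∫V wgt_L`.

WHAT THIS IS NOT: not a claim about Navier–Stokes regularity and not (TV) — one brick of a located stratum's exclusion
(bears_on LADDER-NS N0 via crux K2 = stmt-19708).
-/

noncomputable section

-- the summit and its single sub-problem share the name (CONVENTIONS §1), as in every Theorems file
set_option linter.dupNamespace false

namespace Summit.NavierStokesRegularity.NavierStokesRegularity.Theorems.PoloidalWindowDoorPoloidalWindowRigidityTimeShearVariance

open MeasureTheory Set Function Filter Topology Metric InnerProductSpace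
open scoped RealInnerProductSpace InnerProductSpace Laplacian ContDiff
open Literature.Analysis Literature.Analysis.FluidPDE
open Summit.NavierStokesRegularity.NavierStokesRegularity.Theorems.PoloidalWindowDoorPoloidalWindowRigidityWindow
open Summit.NavierStokesRegularity.NavierStokesRegularity.Theorems.PoloidalWindowDoorPoloidalWindowRigidityHorizontalMean
open Summit.NavierStokesRegularity.NavierStokesRegularity.Theorems.PoloidalWindowDoorPoloidalWindowRigidityConstantShearMeans
open Summit.NavierStokesRegularity.NavierStokesRegularity.Theorems.PoloidalWindowDoorPoloidalWindowRigidityConstantShearSlice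
open Summit.NavierStokesRegularity.NavierStokesRegularity.Theorems.PoloidalWindowDoorPoloidalWindowRigidityConstantShearVariance
open Summit.NavierStokesRegularity.NavierStokesRegularity.Theorems.PoloidalWindowDoorPoloidalWindowRigidityConstantShearGronwall
open Summit.NavierStokesRegularity.NavierStokesRegularity.Theorems.PoloidalWindowDoorPoloidalWindowRigiditySeparatedShearEnergy
open Summit.NavierStokesRegularity.NavierStokesRegularity.Theorems.PoloidalWindowDoorPoloidalWindowRigiditySeparatedShearVariance
open Summit.NavierStokesRegularity.NavierStokesRegularity.Theorems.PoloidalWindowDoorPoloidalWindowRigidityTimeShearPressure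

variable {φ : ContDiffBump (0 : EuclideanSpace ℝ (Fin 2))} {R : ℝ}
  {v : ℝ → EuclideanSpace ℝ (Fin 3) → EuclideanSpace ℝ (Fin 3)} {C : ℝ}

section Class

variable (hrate : HasTypeITimeDecay C v) (hcont : ContinuousOn (uncurry v) (Iio (0 : ℝ) ×ˢ univ))
  (hmild : ∀ s t : ℝ, s < t → t < 0 → ∀ x,
    v t x = UnboundedOperators.heatExtension (v s) (t - s) x - oseenDuhamel 1 s v v t x)
  (hdiv : ∀ t < 0, VectorCalculus.IsDivFree (v t))
  (hpol : ∀ s < 0, ∀ y, ⟪curl (v s) y, EuclideanSpace.single 2 1⟫_ℝ = 0)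
  {μ : ℝ → ℝ}
  (hslope : ∀ s < 0, ∀ y, ∀ b : Fin 3, b ≠ 2 →
    fderiv ℝ (v s) y (EuclideanSpace.single 2 1) b = μ s * fderiv ℝ (v s) y (EuclideanSpace.single b 1) 2)

include hrate hcont hmild hdiv

/-! ### `F = f₂ − κ v₂` is height-only -/

include hpol hslope in
/-- **On (TV), `f₂ − κ v₂` is a function of `x₂` alone** (`κ = μ′/(1−μ(t))`): its horizontal partial derivatives are
`(∂_b f)₂ − κ ∂_b v₂ = 0` by `…TimeShearPressure.timeShear_pressure`, and `f(t,·) = −∇p(t,·)` is smooth (classical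
pressure of the window `(2t,0)`), so it is constant along horizontal segments. -/
theorem residual_vert_sub_eq_of_height_eq_TV {μ' t : ℝ} (ht : t < 0) (hμd : HasDerivAt μ μ' t) (hμ1 : μ t ≠ 1)
    {x x' : EuclideanSpace ℝ (Fin 3)} (hxx' : x 2 = x' 2) :
    (timeDerivWithin (Iio 0) v t x + convect (v t) (v t) x - Δ (v t) x) 2 - μ' / (1 - μ t) * v t x 2 =
      (timeDerivWithin (Iio 0) v t x' + convect (v t) (v t) x' - Δ (v t) x') 2 - μ' / (1 - μ t) * v t x' 2 := by
  have hA : IsTypeIAncientMild C v := isTypeIAncientMild_of_class hrate hcont hmild hdiv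
  have h2t : 2 * t < 0 := by linarith
  have htS : t ∈ Ioo (2 * t) 0 := ⟨by linarith, ht⟩
  obtain ⟨p, hns⟩ := hA.exists_isClassicalNSSolutionOn_Ioo h2t
  have hvd : Differentiable ℝ (v t) := (hA.contDiff_slice ht).differentiable (by simp)
  -- the residual on the window is `−∇p`, a smooth field
  set f : EuclideanSpace ℝ (Fin 3) → EuclideanSpace ℝ (Fin 3) :=
    fun y => timeDerivWithin (Iio 0) v t y + convect (v t) (v t) y - Δ (v t) y with hf
  have hres : f = fun y => -gradient (p t) y := by
    funext y
    have hm := hns.momentum t htS y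
    have hTD : timeDerivWithin (Ioo (2 * t) 0) v t y = timeDerivWithin (Iio 0) v t y := by
      rw [timeDerivWithin_eq_deriv_of_isOpen_subset isOpen_Ioo subset_rfl htS v,
        timeDerivWithin_eq_deriv_of_isOpen_subset isOpen_Iio subset_rfl ht v]
    simp only [hTD, one_smul, Pi.zero_apply, add_zero] at hm
    simp only [hf, hm]
    abel
  have hp : ContDiff ℝ ∞ (p t) := hns.contDiff_pressure htS
  have hfd : Differentiable ℝ f := by
    rw [hres]
    have hg : Differentiable ℝ (gradient (p t)) := by
      have h1 : ContDiff ℝ 1 (fderiv ℝ (p t)) := hp.fderiv_right (m := 1) (by norm_cast)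
      have h2 : gradient (p t) = fun y => (InnerProductSpace.toDual ℝ (EuclideanSpace ℝ (Fin 3))).symm (fderiv ℝ (p t) y) := by
        funext y; rfl
      rw [h2]
      exact (InnerProductSpace.toDual ℝ (EuclideanSpace ℝ (Fin 3))).symm.differentiable.comp
        (h1.differentiable one_ne_zero)
    exact hg.neg
  -- the scalar `F = f₂ − κ v₂` has vanishing horizontal partial derivatives
  set κ : ℝ := μ' / (1 - μ t) with hκ
  set F : EuclideanSpace ℝ (Fin 3) → ℝ := fun y => f y 2 - κ * v t y 2 with hF
  have hFd : Differentiable ℝ F := by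
    have h1 : Differentiable ℝ fun y => f y 2 := fun y =>
      (((EuclideanSpace.proj (𝕜 := ℝ) (2 : Fin 3)).hasFDerivAt).comp y (hfd y).hasFDerivAt).differentiableAt
    have h2 : Differentiable ℝ fun y => v t y 2 := fun y =>
      (((EuclideanSpace.proj (𝕜 := ℝ) (2 : Fin 3)).hasFDerivAt).comp y (hvd y).hasFDerivAt).differentiableAt
    exact h1.sub (h2.const_mul κ)
  have hFb : ∀ y, ∀ b : Fin 3, b ≠ 2 → fderiv ℝ F y (EuclideanSpace.single b (1 : ℝ)) = 0 := by
    intro y b hb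
    have h1 : DifferentiableAt ℝ (fun y => f y 2) y :=
      (((EuclideanSpace.proj (𝕜 := ℝ) (2 : Fin 3)).hasFDerivAt).comp y (hfd y).hasFDerivAt).differentiableAt
    have h2 : DifferentiableAt ℝ (fun y => v t y 2) y :=
      (((EuclideanSpace.proj (𝕜 := ℝ) (2 : Fin 3)).hasFDerivAt).comp y (hvd y).hasFDerivAt).differentiableAt
    have hP := (timeShear_pressure hrate hcont hmild hdiv hpol ht hslope hμd hμ1 y hb).1
    rw [hF, fderiv_fun_sub h1 (h2.const_mul κ), fderiv_const_mul h2]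
    simp only [sub_apply, smul_apply, smul_eq_mul]
    rw [fderiv_coord_apply (hfd y) 2, fderiv_coord_apply (hvd y) 2, hf]
    dsimp only
    rw [hP, hκ]
    ring
  -- integrate along the horizontal segment from `x` to `x'`
  set d : EuclideanSpace ℝ (Fin 3) := x' - x with hd
  have hd2 : d 2 = 0 := by rw [hd]; simp [hxx']
  set γ : ℝ → ℝ := fun s => F (x + s • d) with hγ
  have hγd : ∀ s, HasDerivAt γ 0 s := by
    intro s
    have hline : HasDerivAt (fun s : ℝ => x + s • d) d s := by
      simpa using ((hasDerivAt_id s).smul_const d).const_add x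
    have h := (hFd (x + s • d)).hasFDerivAt.comp_hasDerivAt s hline
    have hzero : fderiv ℝ F (x + s • d) d = 0 := by
      rw [fderiv_apply_eq_sum]
      simp only [Fin.sum_univ_three, hFb _ 0 (by decide), hFb _ 1 (by decide), hd2, mul_zero, zero_mul, add_zero]
    rw [hzero] at h
    exact h
  have hconst := is_const_of_deriv_eq_zero (fun s => (hγd s).differentiableAt) (fun s => (hγd s).deriv) 0 1
  simp only [hγ, zero_smul, add_zero, one_smul] at hconst
  have hx' : x + d = x' := by rw [hd]; abel
  rw [hx'] at hconst
  exact hconst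

/-! ### The production is non-negative on (TV) -/

omit hrate hcont hmild hdiv in
include hslope in
/-- On (TV) with `μ(t) ≤ 1` the Clebsch production `∇_h v₂·(∇_h v₂ − ∂₂v_h) = (1 − μ(t))|∇_h v₂|²` is non-negative. -/
theorem prod_nonneg_TV {t : ℝ} (ht : t < 0) (hμle : μ t ≤ 1) (hvd : Differentiable ℝ (v t))
    (x : EuclideanSpace ℝ (Fin 3)) :
    0 ≤ fderiv ℝ (fun y => v t y 2) x (EuclideanSpace.single 0 (1 : ℝ)) *
          (fderiv ℝ (fun y => v t y 2) x (EuclideanSpace.single 0 (1 : ℝ)) - fderiv ℝ (v t) x (EuclideanSpace.single 2 (1 : ℝ)) 0) +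
        fderiv ℝ (fun y => v t y 2) x (EuclideanSpace.single 1 (1 : ℝ)) *
          (fderiv ℝ (fun y => v t y 2) x (EuclideanSpace.single 1 (1 : ℝ)) - fderiv ℝ (v t) x (EuclideanSpace.single 2 (1 : ℝ)) 1) := by
  rw [fderiv_coord_apply (hvd x) 2, fderiv_coord_apply (hvd x) 2, hslope t ht x 0 (by decide),
    hslope t ht x 1 (by decide)]
  have h1 : 0 ≤ 1 - μ t := by linarith
  nlinarith [sq_nonneg (fderiv ℝ (v t) x (EuclideanSpace.single 0 (1 : ℝ)) 2),
    sq_nonneg (fderiv ℝ (v t) x (EuclideanSpace.single 1 (1 : ℝ)) 2),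
    mul_nonneg h1 (sq_nonneg (fderiv ℝ (v t) x (EuclideanSpace.single 0 (1 : ℝ)) 2)),
    mul_nonneg h1 (sq_nonneg (fderiv ℝ (v t) x (EuclideanSpace.single 1 (1 : ℝ)) 2))]

include hslope in
/-- On (TV) with `μ(t) ≤ 1` the averaged production `Dsep(t,·)` is non-negative. -/
theorem sliceDsep_nonneg_TV {t : ℝ} (ht : t < 0) (hμle : μ t ≤ 1) (z : ℝ) : 0 ≤ sliceDsep φ R v t z := by
  have hA : IsTypeIAncientMild C v := isTypeIAncientMild_of_class hrate hcont hmild hdiv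
  have hvd : Differentiable ℝ (v t) := (hA.contDiff_slice ht).differentiable (by simp)
  exact hmean_nonneg φ 0 R z fun x => prod_nonneg_TV hslope ht hμle hvd x

/-! ### The KEY inequality on (TV) -/

include hpol hslope in
/-- **KEY INEQUALITY ON (TV)**: for a profile of the class with all-slices proportional shear of slope `μ(·)`,
differentiable at `t` with `μ(t) ≠ 1`, and gradient rate `C₁`:
`∂ₜV − 2κV + 2∂_zG + 2Dsep ≤ R⁻¹(8M₀³ + 8M₀M₁)(‖∂₀φ̄‖₁+‖∂₁φ̄‖₁)`, `κ = μ′/(1−μ(t))`, `M₀ = C/√(−t)`, `M₁ = C₁/(−t)`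
(K2-p2's `key_mean_sep` with the time-derivative slot `∂ₜv₂ − κ v₂` and the height-only source `f₂ − κ v₂`). -/
theorem key_slice_TV {μ' t : ℝ} (ht : t < 0) (hμd : HasDerivAt μ μ' t) (hμ1 : μ t ≠ 1)
    {C₁ : ℝ} (hC₁ : ∀ t < 0, ∀ y, ‖fderiv ℝ (v t) y‖ ≤ C₁ / (-t)) (hR : 0 < R) (z : ℝ) :
    sliceVt φ R v t z - 2 * (μ' / (1 - μ t)) * sliceV φ R v t z + 2 * sliceGz φ R v t z + 2 * sliceDsep φ R v t z ≤
      R⁻¹ * (8 * (C / Real.sqrt (-t) * (C / Real.sqrt (-t)) * (C / Real.sqrt (-t))) +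
        8 * (C / Real.sqrt (-t) * (C₁ / (-t)))) * bumpK φ := by
  have hA : IsTypeIAncientMild C v := isTypeIAncientMild_of_class hrate hcont hmild hdiv
  have hu : ContDiff ℝ 2 (v t) := (hA.contDiff_slice ht).of_le (by norm_cast)
  have hdiv' := fun x => div_coord (hdiv t ht) x
  set κ : ℝ := μ' / (1 - μ t) with hκ
  -- the shifted time-derivative slot `θt = ∂ₜv₂ − κ v₂`
  have hθc : Continuous (fun x => v t x 2) := (contDiff_coord hu 2).continuous
  have hvtc : Continuous (fun x => deriv (fun s => v s x) t 2) := (contDiff_vertT hrate hcont hmild hdiv ht).continuous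
  set θt : EuclideanSpace ℝ (Fin 3) → ℝ := fun x => deriv (fun s => v s x) t 2 - κ * v t x 2 with hθt
  have hθtc : Continuous θt := hvtc.sub (continuous_const.mul hθc)
  -- the vertical momentum equation with the height-only source `F(x₂ e₂)`
  set g : ℝ → ℝ := fun ζ => (timeDerivWithin (Iio 0) v t (ζ • EuclideanSpace.single 2 (1 : ℝ)) +
      convect (v t) (v t) (ζ • EuclideanSpace.single 2 (1 : ℝ)) - Δ (v t) (ζ • EuclideanSpace.single 2 (1 : ℝ))) 2 -
    κ * v t (ζ • EuclideanSpace.single 2 (1 : ℝ)) 2 with hg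
  have heq : ∀ x, θt x + fderiv ℝ (fun y => v t y 2) x (v t x) -
      ∑ i : Fin 3, fderiv ℝ (fun y => fderiv ℝ (fun y' => v t y' 2) y (EuclideanSpace.single i (1 : ℝ))) x
        (EuclideanSpace.single i (1 : ℝ)) = g (x 2) := by
    intro x
    have hv := vertical_equation_coord hrate hcont hmild hdiv ht x
    have hh := residual_vert_sub_eq_of_height_eq_TV hrate hcont hmild hdiv hpol hslope ht hμd hμ1
      (x := x) (x' := x 2 • EuclideanSpace.single 2 (1 : ℝ)) (by simp)
    rw [← hκ] at hh
    rw [hθt, hg]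
    dsimp only
    rw [← (hasDerivAt_vert hrate hcont hmild hdiv ht x).deriv]
    linarith [hv, hh]
  have key := key_mean_sep φ 0 z hu hdiv' (fun x => hrate t ht x) (hC₁ t ht) hθtc heq hR
  -- rewrite the two means containing `θt`
  have e1 : hmean φ 0 R z (fun x => 2 * v t x 2 * θt x) =
      hmean φ 0 R z (fun x => 2 * v t x 2 * deriv (fun s => v s x) t 2) - 2 * κ * hmean φ 0 R z (fun x => v t x 2 ^ 2) := by
    have hfun : (fun x => 2 * v t x 2 * θt x) =
        fun x => 2 * v t x 2 * deriv (fun s => v s x) t 2 - 2 * κ * (v t x 2 ^ 2) := by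
      funext x; rw [hθt]; ring
    calc hmean φ 0 R z (fun x => 2 * v t x 2 * θt x)
        = hmean φ 0 R z (fun x => 2 * v t x 2 * deriv (fun s => v s x) t 2 - 2 * κ * (v t x 2 ^ 2)) := by rw [hfun]
      _ = hmean φ 0 R z (fun x => 2 * v t x 2 * deriv (fun s => v s x) t 2) -
            hmean φ 0 R z (fun x => 2 * κ * (v t x 2 ^ 2)) :=
          hmean_sub φ 0 R z ((continuous_const.mul hθc).mul hvtc) (continuous_const.mul (hθc.pow 2))
      _ = _ := by rw [hmean_const_mul φ 0 R z (fun x => v t x 2 ^ 2) (2 * κ)]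
  have e2 : hmean φ 0 R z θt = hmean φ 0 R z (fun x => deriv (fun s => v s x) t 2) - κ * hmean φ 0 R z (fun x => v t x 2) := by
    calc hmean φ 0 R z θt
        = hmean φ 0 R z (fun x => deriv (fun s => v s x) t 2 - κ * v t x 2) := by rw [hθt]
      _ = hmean φ 0 R z (fun x => deriv (fun s => v s x) t 2) - hmean φ 0 R z (fun x => κ * v t x 2) :=
          hmean_sub φ 0 R z hvtc (continuous_const.mul hθc)
      _ = _ := by rw [hmean_const_mul φ 0 R z (fun x => v t x 2) κ]
  rw [e1, e2] at key
  unfold sliceVt sliceGz sliceDsep sliceV sliceM sliceE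
  linarith [key]

/-! ### `Ψ' ≤ (3M₀/L + 2κ)Ψ + πL·K/R` -/

include hpol hslope in
/-- **`Ψ' ≤ (3M₀/L)Ψ + 2κΨ + πL·K(t)/R`** on (TV) (`κ = μ′/(1 − μ(t))`, `μ(t) < 1`): K2-p2's `deriv_psi_le_sep` with the
source `2κV` of `key_slice_TV` carried along. -/
theorem deriv_psi_le_TV {μ' t : ℝ} (ht : t < 0) (hμd : HasDerivAt μ μ' t) (hμlt : μ t < 1)
    {C₁ : ℝ} (hC₁ : ∀ t < 0, ∀ y, ‖fderiv ℝ (v t) y‖ ≤ C₁ / (-t)) (hR : 0 < R) {L : ℝ} (hL : 0 < L) :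
    ∫ z, sliceVt φ R v t z * wgt L z ≤
      3 * (C / Real.sqrt (-t)) / L * psi φ R v L t + 2 * (μ' / (1 - μ t)) * psi φ R v L t +
        R⁻¹ * (8 * (C / Real.sqrt (-t) * (C / Real.sqrt (-t)) * (C / Real.sqrt (-t))) +
          8 * (C / Real.sqrt (-t) * (C₁ / (-t)))) * bumpK φ * (Real.pi * L) := by
  have hμ1 : μ t ≠ 1 := hμlt.ne
  obtain ⟨cV, cVt, cG, cGz⟩ := continuous_slices (φ := φ) (R := R) hrate hcont hmild hdiv ht
  set M₀ := C / Real.sqrt (-t) with hM₀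
  set κ : ℝ := μ' / (1 - μ t) with hκ
  set Kt := R⁻¹ * (8 * (M₀ * M₀ * M₀) + 8 * (M₀ * (C₁ / (-t)))) * bumpK φ with hKt
  have hM₀0 : 0 ≤ M₀ := (norm_nonneg _).trans (hrate t ht 0)
  -- integrability of the pieces against the weight
  have iVt : Integrable fun z => sliceVt φ R v t z * wgt L z := by
    obtain ⟨C₄, hC₄⟩ := Summit.NavierStokesRegularity.NavierStokesRegularity.Theorems.PoloidalWindowDoorPoloidalWindowRigidityConstantShearSlice.exists_timeDeriv_rate_of_class
      hrate hcont hmild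
    refine integrable_of_abs_le_mul_wgt hL.ne' (cVt.mul (continuous_wgt L))
      (B := 4 * (C / Real.sqrt (-t)) * (C₄ / ((-t) * Real.sqrt (-t)))) fun z => ?_
    rw [abs_mul, abs_of_pos (wgt_pos L z)]
    exact mul_le_mul_of_nonneg_right (abs_sliceVt_le hrate hcont hmild hdiv hC₄ ht z) (wgt_pos L z).le
  have iGz : Integrable fun z => sliceGz φ R v t z * wgt L z := by
    refine integrable_of_abs_le_mul_wgt hL.ne' (cGz.mul (continuous_wgt L))
      (B := 6 * (C / Real.sqrt (-t)) ^ 2 * (C₁ / (-t))) fun z => ?_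
    rw [abs_mul, abs_of_pos (wgt_pos L z)]
    exact mul_le_mul_of_nonneg_right (abs_sliceGz_le hrate hcont hmild hdiv hC₁ ht z) (wgt_pos L z).le
  obtain ⟨cD, hDb⟩ := continuous_sliceDsep_and_le (φ := φ) (R := R) hrate hcont hmild hdiv hC₁ ht
  have hD0 : ∀ z, 0 ≤ sliceDsep φ R v t z := fun z => sliceDsep_nonneg_TV hrate hcont hmild hdiv hslope ht hμlt.le z
  have iD : Integrable fun z => sliceDsep φ R v t z * wgt L z := by
    refine integrable_of_abs_le_mul_wgt hL.ne' (cD.mul (continuous_wgt L)) (B := 4 * (C₁ / (-t)) ^ 2) fun z => ?_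
    rw [abs_mul, abs_of_pos (wgt_pos L z)]
    exact mul_le_mul_of_nonneg_right (hDb z) (wgt_pos L z).le
  have iG : Integrable fun z => sliceG φ R v t z * wgt L z := by
    refine integrable_of_abs_le_mul_wgt hL.ne' (cG.mul (continuous_wgt L)) (B := 3 / 2 * M₀ * (C ^ 2 / (-t))) fun z => ?_
    rw [abs_mul, abs_of_pos (wgt_pos L z)]
    refine mul_le_mul_of_nonneg_right ((abs_sliceG_le hrate hcont hmild hdiv ht z).trans ?_) (wgt_pos L z).le
    exact mul_le_mul_of_nonneg_left (sliceV_le hrate hcont hmild hdiv ht z) (by positivity)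
  have iV : Integrable fun z => sliceV φ R v t z * wgt L z := by
    refine integrable_of_abs_le_mul_wgt hL.ne' (cV.mul (continuous_wgt L)) (B := C ^ 2 / (-t)) fun z => ?_
    rw [abs_mul, abs_of_pos (wgt_pos L z), abs_of_nonneg (sliceV_nonneg hrate hcont hmild hdiv ht z)]
    exact mul_le_mul_of_nonneg_right (sliceV_le hrate hcont hmild hdiv ht z) (wgt_pos L z).le
  -- (1) integrate the KEY inequality against the (positive) weight
  have i12 : Integrable fun z => (-2) * (sliceGz φ R v t z * wgt L z) + (-2) * (sliceDsep φ R v t z * wgt L z) :=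
    (iGz.const_mul _).add (iD.const_mul _)
  have iK : Integrable fun z => Kt * wgt L z := (integrable_wgt hL.ne').const_mul _
  have iS : Integrable fun z => (2 * κ) * (sliceV φ R v t z * wgt L z) := iV.const_mul _
  have i123 : Integrable fun z => (-2) * (sliceGz φ R v t z * wgt L z) + (-2) * (sliceDsep φ R v t z * wgt L z) +
      Kt * wgt L z := i12.add iK
  have h1 : ∫ z, sliceVt φ R v t z * wgt L z ≤
      ∫ z, ((-2) * (sliceGz φ R v t z * wgt L z) + (-2) * (sliceDsep φ R v t z * wgt L z) + Kt * wgt L z +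
        (2 * κ) * (sliceV φ R v t z * wgt L z)) := by
    refine integral_mono iVt (i123.add iS) fun z => ?_
    have hk := key_slice_TV (φ := φ) hrate hcont hmild hdiv hpol hslope ht hμd hμ1 hC₁ hR z
    have hw := wgt_pos L z
    rw [← hκ] at hk
    nlinarith
  rw [integral_add i123 iS, integral_add i12 iK, integral_add (iGz.const_mul _) (iD.const_mul _),
    integral_const_mul, integral_const_mul, integral_const_mul, integral_const_mul, integral_wgt hL] at h1
  -- (2) the production term is nonpositive
  have h2 : (-2) * ∫ z, sliceDsep φ R v t z * wgt L z ≤ 0 := by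
    have hD : 0 ≤ ∫ z, sliceDsep φ R v t z * wgt L z :=
      integral_nonneg fun z => mul_nonneg (hD0 z) (wgt_pos L z).le
    nlinarith
  -- (3) one integration by parts in the height: `∫ ∂_zG wgt = −∫ G wgt'`
  have h3 : ∫ z, sliceGz φ R v t z * wgt L z =
      -∫ z, sliceG φ R v t z * (-(2 * (z / L) * L⁻¹) / (1 + (z / L) ^ 2) ^ 2) := by
    have hG' : ∀ z, fderiv ℝ (fun ζ => sliceG φ R v t ζ) z 1 = sliceGz φ R v t z := fun z => by
      rw [fderiv_apply_one_eq_deriv, (hasDerivAt_sliceG hrate hcont hmild hdiv ht z).deriv]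
    have hw' : ∀ z, fderiv ℝ (wgt L) z 1 = -(2 * (z / L) * L⁻¹) / (1 + (z / L) ^ 2) ^ 2 := fun z => by
      rw [fderiv_apply_one_eq_deriv, (hasDerivAt_wgt L z).deriv]
    have hibp := integral_mul_fderiv_eq_neg_fderiv_mul_of_integrable (μ := (volume : Measure ℝ))
      (f := fun ζ => sliceG φ R v t ζ) (g := wgt L) (v := (1 : ℝ)) ?_ ?_ ?_ ?_ ?_
    · simp only [hG', hw'] at hibp
      rw [hibp, neg_neg]
    · simp only [hG']; exact iGz
    · simp only [hw']
      refine integrable_of_abs_le_mul_wgt hL.ne' (cG.mul (continuous_deriv_wgt L))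
        (B := 3 / 2 * M₀ * (C ^ 2 / (-t)) / L) fun z => ?_
      rw [abs_mul]
      calc |sliceG φ R v t z| * |-(2 * (z / L) * L⁻¹) / (1 + (z / L) ^ 2) ^ 2|
          ≤ (3 / 2 * M₀ * sliceV φ R v t z) * (wgt L z / L) :=
            mul_le_mul (abs_sliceG_le hrate hcont hmild hdiv ht z) (abs_deriv_wgt_le hL z) (abs_nonneg _)
              (by have := sliceV_nonneg (φ := φ) (R := R) hrate hcont hmild hdiv ht z; positivity)
        _ ≤ (3 / 2 * M₀ * (C ^ 2 / (-t))) * (wgt L z / L) :=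
            mul_le_mul_of_nonneg_right (mul_le_mul_of_nonneg_left (sliceV_le hrate hcont hmild hdiv ht z)
              (by positivity)) (div_nonneg (wgt_pos L z).le hL.le)
        _ = _ := by ring
    · exact iG
    · exact fun z _ => (hasDerivAt_sliceG hrate hcont hmild hdiv ht z).differentiableAt
    · exact fun z _ => (hasDerivAt_wgt L z).differentiableAt
  -- (4) `|∫ G wgt'| ≤ (3M₀/(2L)) Ψ`
  have h4 : |∫ z, sliceG φ R v t z * (-(2 * (z / L) * L⁻¹) / (1 + (z / L) ^ 2) ^ 2)| ≤
      3 / 2 * M₀ / L * psi φ R v L t := by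
    unfold psi
    rw [← integral_const_mul]
    refine (abs_integral_le_integral_abs).trans (integral_mono_of_nonneg (Eventually.of_forall fun z => abs_nonneg _)
      (iV.const_mul _) (Eventually.of_forall fun z => ?_))
    dsimp only
    rw [abs_mul]
    calc |sliceG φ R v t z| * |-(2 * (z / L) * L⁻¹) / (1 + (z / L) ^ 2) ^ 2|
        ≤ (3 / 2 * M₀ * sliceV φ R v t z) * (wgt L z / L) :=
          mul_le_mul (abs_sliceG_le hrate hcont hmild hdiv ht z) (abs_deriv_wgt_le hL z) (abs_nonneg _)
            (by have := sliceV_nonneg (φ := φ) (R := R) hrate hcont hmild hdiv ht z; positivity)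
      _ = 3 / 2 * M₀ / L * (sliceV φ R v t z * wgt L z) := by ring
  -- assemble
  have h5 : (-2) * ∫ z, sliceGz φ R v t z * wgt L z ≤ 3 * M₀ / L * psi φ R v L t := by
    rw [h3]
    set I := ∫ z, sliceG φ R v t z * (-(2 * (z / L) * L⁻¹) / (1 + (z / L) ^ 2) ^ 2) with hI
    have hI2 := (abs_le.1 h4).2
    have e1 : (-2 : ℝ) * -I = 2 * I := by ring
    have e2 : 3 * M₀ / L * psi φ R v L t = 2 * (3 / 2 * M₀ / L * psi φ R v L t) := by ring
    rw [e1, e2]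
    exact mul_le_mul_of_nonneg_left hI2 zero_le_two
  have h6 : (2 * κ) * ∫ z, sliceV φ R v t z * wgt L z = 2 * κ * psi φ R v L t := by unfold psi; rfl
  have e3 : 3 * (C / Real.sqrt (-t)) / L * psi φ R v L t = 3 * M₀ / L * psi φ R v L t := by rw [hM₀]
  rw [e3]
  linarith [h1, h2, h5, h6]

end Class

end Summit.NavierStokesRegularity.NavierStokesRegularity.Theorems.PoloidalWindowDoorPoloidalWindowRigidityTimeShearVariance

end
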